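import Literature.AnabelianGeometry.SemiGraphs.TemperedLevelData
import Literature.AnabelianGeometry.SemiGraphs.TemperedMaximalCompact
import Literature.AnabelianGeometry.SemiGraphs.TreeSystemHstar
import Literature.AnabelianGeometry.SemiGraphs.InverseSystemEventuallySingleton
import Literature.AnabelianGeometry.SemiGraphs.TemperedEdgeInVerticialProofs
import HarnessLib

/-!
# [SemiAnbd] Theorem 3.7 (iii) over the level data of a chart, along the author's Comments (6)

Mochizuki, *Semi-graphs of anabelioids*, Publ. RIMS **42** (2006), §3, Theorem 3.7 (iii), manuscript
pp. 40–41 [cite: MochizukiSemiAnbd2006, Thm 3.7(iii) pp.40-41], proved as in the author's *Comments*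
(May 2020), item (6) (cell file HOME/lit/SemiAnbd-Comments-2020.txt): with `V_i`, `E_i` the `H`-fixed
vertices / closed edges of the trees `𝒢_{i,∞}` and `E_{j,i}` the image of `E_i` in `E_j`, "(a) Suppose
that for some cofinal subset `J ⊆ I`, we have `#V_j = 1` … `H` is contained in some verticial subgroup
… (b) Suppose … `#V_j ≥ 2` … (∗_j) there exists an `i ∈ J` such that `i ≥ j` and `#E_{j,i} = 1` … the
unique elements of the `E_{j,∞}` form a compatible system of closed edges fixed by `H` … `H` is contained
in some edge-like subgroup, hence also in two distinct verticial subgroups … (c) … If `H` is contained in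
three distinct verticial subgroups, then … one obtains a contradiction to the condition (∗_j)."

This PROOF-ONLY file assembles BOTH conjuncts of `ProfiniteSemiGraph.CompactInVerticial` for a chart
`c : TemperedPiChart 𝒢` from its level data `D : VerticialLevelData 𝒢 c` (`TemperedLevelData.lean`),
modulo three named inputs: Theorem 3.7 (ii) (`VerticialDistinct`, for "nested verticial subgroups are
equal"), Theorem 3.7 (i) existence (`hex`: every vertex carries a verticial subgroup), and the condition
(∗_j) for every nontrivial compact subgroup (`hstar`: "for every `j` there is `i ≥ j` such that all
`C`-fixed edges of the tree `T_i` have ONE image in `T_j`" — the output of total estrangement, Comments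
(6)(b); seat abc-iut-L3-t11's `hstar_of_noFixedBranchPairSystem`; cell ruling θ2):

* `VerticialLevelData.hstar_restrict` — (∗_j) descends to a cofinal set of levels;
* `VerticialLevelData.exists_compatible_fixed_edges` — (b): at every level two fixed vertices + (∗_j)
  ⇒ a compatible system of `C`-fixed edges with abutting branches (via
  `exists_compatible_of_eventually_subsingleton_image`, seat abc-iut-L3-t6);
* `VerticialLevelData.conj1_of_hstar` — first part of (iii) for `C` satisfying (∗_j): case (a) by
  `conj1_of_caseB` (abc-iut-L3-t6's case (a)), case (b) by the edge system, (I3) and "edge-like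
  subgroups lie in verticial ones" (`exists_mem_verticialSubgroups_ge`, seat abc-iut-L3-t11);
* `VerticialLevelData.conj2_of_hstar` — second part of (iii): abc-iut-L3-t11's
  `compactInVerticial_conj2_of_levelData` argument with its two tree-system steps replaced by
  `atMostTwo_systems_of_hstar` / `adjacent_of_hstar` (`TreeSystemHstar.lean`);
* `VerticialLevelData.compactInVerticial_of_hstar` — the body of `CompactInVerticial` for `c` (the
  trivial subgroup handled by `hex`).
No definitions; nothing here takes a side on [IUTchIII] Cor. 3.12.
-/

namespace Literature.AnabelianGeometry.SemiGraphs

namespace ProfiniteSemiGraph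

namespace VerticialLevelData

open CategoryTheory Topology

universe v u

variable {𝒢 : ProfiniteSemiGraph.{u}} {c : TemperedPiChart 𝒢} (D : VerticialLevelData.{v} 𝒢 c)

/-! ### (∗_j) descends to cofinal sets of levels -/

/-- **(∗_j) on a cofinal set of levels**: if all `C`-fixed edges of `T_i` (`i = i(j) ≥ j`) have one
image in `T_j`, the same holds for the restricted data (push the level `i` up into the cofinal set by
equivariance and functoriality of the transition maps). [cite: MochizukiSemiAnbd2006, Thm 3.7(iii) p.41] -/
theorem hstar_restrict (C : Subgroup c.G) (S : Set D.J) (hS : ∀ j : D.J, ∃ s ∈ S, j ≤ s)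
    (hstar : ∀ j : D.J, ∃ (i : D.J) (h : j ≤ i), ∀ e e' : (D.tree i).Edge,
      (∀ γ : C, (D.act i γ).hom.edgeMap e = e) → (∀ γ : C, (D.act i γ).hom.edgeMap e' = e') →
      (D.trans h).edgeMap e = (D.trans h).edgeMap e') :
    ∀ s : (D.restrict S hS).J, ∃ (t : (D.restrict S hS).J) (h : s ≤ t),
      ∀ e e' : ((D.restrict S hS).tree t).Edge,
      (∀ γ : C, ((D.restrict S hS).act t γ).hom.edgeMap e = e) →
      (∀ γ : C, ((D.restrict S hS).act t γ).hom.edgeMap e' = e') →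
      ((D.restrict S hS).trans h).edgeMap e = ((D.restrict S hS).trans h).edgeMap e' := by
  rintro ⟨s, hs⟩
  obtain ⟨i, hsi, H⟩ := hstar s
  obtain ⟨t, ht, hit⟩ := hS i
  refine ⟨⟨t, ht⟩, hsi.trans hit, fun e e' he he' => ?_⟩
  change (D.trans (hsi.trans hit)).edgeMap e = (D.trans (hsi.trans hit)).edgeMap e'
  rw [← D.trans_edgeMap_comp hsi hit, ← D.trans_edgeMap_comp hsi hit]
  have he₀ : ∀ γ : C, (D.act t γ).hom.edgeMap e = e := he
  have he₀' : ∀ γ : C, (D.act t γ).hom.edgeMap e' = e' := he'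
  refine H _ _ (fun γ => ?_) (fun γ => ?_)
  · rw [← D.trans_act_edgeMap, he₀]
  · rw [← D.trans_act_edgeMap, he₀']

/-! ### Case (b): the compatible system of fixed edges -/

/-- **Comments (6)(b): the compatible system of fixed edges.**  If at every level the trees carry two
distinct `C`-fixed vertices and (∗_j) holds, there is a compatible system of `C`-fixed edges each having
a branch abutting to a vertex ("the unique elements of the `E_{j,∞}`"): the fixed geodesic between two
fixed vertices contains such an edge (Lemma 1.8 (ii)(b)), these sets are stable under the transition
maps, and their images are eventually single points. [cite: MochizukiSemiAnbd2006, Thm 3.7(iii) p.41] -/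
theorem exists_compatible_fixed_edges (C : Subgroup c.G)
    (htwo : ∀ j : D.J, ∃ a b : (D.tree j).Vertex, a ≠ b ∧ (∀ γ : C, (D.act j γ).hom.vertexMap a = a) ∧
      ∀ γ : C, (D.act j γ).hom.vertexMap b = b)
    (hstar : ∀ j : D.J, ∃ (i : D.J) (h : j ≤ i), ∀ e e' : (D.tree i).Edge,
      (∀ γ : C, (D.act i γ).hom.edgeMap e = e) → (∀ γ : C, (D.act i γ).hom.edgeMap e' = e') →
      (D.trans h).edgeMap e = (D.trans h).edgeMap e') :
    ∃ ε : ∀ j, (D.tree j).Edge,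
      (∀ j, (∃ (b : (D.tree j).Branch) (w : (D.tree j).Vertex),
        (D.tree j).edgeOf b = ε j ∧ (D.tree j).abuts b = some w) ∧
        ∀ γ : C, (D.act j γ).hom.edgeMap (ε j) = ε j) ∧
      ∀ ⦃i j : D.J⦄ (h : i ≤ j), (D.trans h).edgeMap (ε j) = ε i := by
  -- the sets `F_j` of fixed edges with an abutting branch
  let F : ∀ j : D.J, Set (D.tree j).Edge := fun j =>
    {e | (∃ (b : (D.tree j).Branch) (w : (D.tree j).Vertex),
      (D.tree j).edgeOf b = e ∧ (D.tree j).abuts b = some w) ∧ ∀ γ : C, (D.act j γ).hom.edgeMap e = e}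
  have hne : ∀ j, (F j).Nonempty := by
    intro j
    obtain ⟨a, b, hab, ha, hb⟩ := htwo j
    have hA : (D.tree j).subdivision.IsAcyclic := (D.isTree j).isTree.isAcyclic
    obtain ⟨p, hp⟩ := (D.isTree j).isTree.connected.exists_isPath (Sum.inl a) (Sum.inl b)
    have fixp : ∀ z ∈ p.support, ∀ γ : C, SemiGraph.nodeMap (D.act j γ) z = z := fun z hz γ =>
      SemiGraph.nodeMap_eq_self_of_isPath hA (D.act j γ) (by simp [ha γ]) (by simp [hb γ]) p hp z hz
    rcases SemiGraph.path_between_vertices_shape hab p hp with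
      ⟨v, e₁, -, c₁, -, -, hc₁e, hc₁v, -, -, -, he₁s, -⟩ | ⟨e, c₀, -, -, hce, -, hca, -, hes⟩
    · exact ⟨e₁, ⟨c₁, v, hc₁e, hc₁v⟩, fun γ => by simpa using fixp _ he₁s γ⟩
    · exact ⟨e, ⟨c₀, a, hce, hca⟩, fun γ => by simpa using fixp _ hes γ⟩
  have hmap : ∀ ⦃i j : D.J⦄ (h : i ≤ j) (x : (D.tree j).Edge), x ∈ F j → (D.trans h).edgeMap x ∈ F i := by
    rintro i j h x ⟨⟨b, w, hbx, hbw⟩, hfix⟩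
    refine ⟨⟨(D.trans h).branchMap b, (D.trans h).vertexMap w, ?_, (D.trans h).abuts_branchMap b w hbw⟩,
      fun γ => ?_⟩
    · rw [(D.trans h).edgeOf_branchMap, hbx]
    · rw [← D.trans_act_edgeMap, hfix]
  have hstar' : ∀ j, ∃ (i : D.J) (h : j ≤ i), ((fun x => (D.trans h).edgeMap x) '' F i).Subsingleton := by
    intro j
    obtain ⟨i, h, H⟩ := hstar j
    refine ⟨i, h, ?_⟩
    rintro _ ⟨e, he, rfl⟩ _ ⟨e', he', rfl⟩
    exact H e e' he.2 he'.2
  obtain ⟨ε, hεF, hεc⟩ := SemiGraph.exists_compatible_of_eventually_subsingleton_image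
    (fun i j (h : i ≤ j) => (D.trans h).edgeMap) (fun i j k hij hjk x => D.trans_edgeMap_comp hij hjk x)
    F hne hmap hstar'
  exact ⟨ε, fun j => hεF j, hεc⟩

/-- **Comments (6)(b), conclusion**: under the hypotheses of `exists_compatible_fixed_edges`, `C` lies in
an edge-like subgroup (identification (I3)) and hence — every vertex carrying a verticial subgroup,
Thm. 3.7 (i) — in a verticial subgroup. [cite: MochizukiSemiAnbd2006, Thm 3.7(iii) p.41] -/
theorem conj1_of_two_fixed (C : Subgroup c.G) (hex : ∀ v : 𝒢.graph.Vertex, (verticialSubgroups c v).Nonempty)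
    (htwo : ∀ j : D.J, ∃ a b : (D.tree j).Vertex, a ≠ b ∧ (∀ γ : C, (D.act j γ).hom.vertexMap a = a) ∧
      ∀ γ : C, (D.act j γ).hom.vertexMap b = b)
    (hstar : ∀ j : D.J, ∃ (i : D.J) (h : j ≤ i), ∀ e e' : (D.tree i).Edge,
      (∀ γ : C, (D.act i γ).hom.edgeMap e = e) → (∀ γ : C, (D.act i γ).hom.edgeMap e' = e') →
      (D.trans h).edgeMap e = (D.trans h).edgeMap e') :
    ∃ (v : 𝒢.graph.Vertex) (H : Subgroup c.G), H ∈ verticialSubgroups c v ∧ C ≤ H := by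
  obtain ⟨ε, hε, hεc⟩ := D.exists_compatible_fixed_edges C htwo hstar
  obtain ⟨j₁⟩ := D.nonempty
  -- (I3) on the eventual system `ε|_{j ≥ j₁}`
  obtain ⟨e, L, hL, hpe, hLstab⟩ :=
    D.edge j₁ (fun j => ε j.1) (fun i j h => hεc h)
  have hCL : C ≤ L := by
    intro g hg
    refine hLstab g fun j => ⟨(hε j.1).2 ⟨g, hg⟩, fun b hb => ?_⟩
    exact D.branchMap_eq_of_edgeMap_eq j.1 g b (by rw [hb]; exact (hε j.1).2 ⟨g, hg⟩)
  -- a branch of `e` abutting to a vertex, image of one of `ε j₁`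
  obtain ⟨⟨b, w, hbε, hbw⟩, -⟩ := hε j₁
  have hpb : 𝒢.graph.edgeOf ((D.proj j₁).branchMap b) = e := by
    rw [(D.proj j₁).edgeOf_branchMap, hbε]
    exact hpe ⟨j₁, le_rfl⟩
  obtain ⟨H, hH, hLH⟩ := exists_mem_verticialSubgroups_ge c ((D.proj j₁).abuts_branchMap b w hbw)
    (hpb ▸ hL) (hex _)
  exact ⟨_, H, hH, hCL.trans hLH⟩

/-! ### The first part of (iii) under (∗_j) -/

/-- **Thm. 3.7 (iii), first part, for a subgroup satisfying (∗_j)** (Comments (6)(a),(b),(c)): a compact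
`C` satisfying (∗_j) lies in a verticial subgroup — case (a) (`conj1_of_caseB`, abc-iut-L3-t6), or case
(b) on the cofinal set of levels with two fixed vertices (`conj1_of_two_fixed` for the restricted data,
(∗_j) descending by `hstar_restrict`). [cite: MochizukiSemiAnbd2006, Thm 3.7(iii) p.41] -/
theorem conj1_of_hstar (C : Subgroup c.G) (hC : IsCompact (C : Set c.G))
    (hex : ∀ v : 𝒢.graph.Vertex, (verticialSubgroups c v).Nonempty)
    (hstar : ∀ j : D.J, ∃ (i : D.J) (h : j ≤ i), ∀ e e' : (D.tree i).Edge,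
      (∀ γ : C, (D.act i γ).hom.edgeMap e = e) → (∀ γ : C, (D.act i γ).hom.edgeMap e' = e') →
      (D.trans h).edgeMap e = (D.trans h).edgeMap e') :
    ∃ (v : 𝒢.graph.Vertex) (H : Subgroup c.G), H ∈ verticialSubgroups c v ∧ C ≤ H := by
  refine D.conj1_of_caseB C hC fun hB => ?_
  -- the cofinal set of levels with at least two fixed vertices
  let S : Set D.J := {s | ¬ {x : (D.tree s).Vertex | ∀ g : C, (D.act s g).hom.vertexMap x = x}.Subsingleton}
  have hS : ∀ j : D.J, ∃ s ∈ S, j ≤ s := fun j => let ⟨s, hs, hjs⟩ := hB j; ⟨s, hs, hjs⟩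
  refine (D.restrict S hS).conj1_of_two_fixed C hex (fun s => ?_) (D.hstar_restrict C S hS hstar)
  have hs : ¬ {x : (D.tree s.1).Vertex | ∀ g : C, (D.act s.1 g).hom.vertexMap x = x}.Subsingleton := s.2
  rw [Set.not_subsingleton_iff] at hs
  obtain ⟨a, ha, b, hb, hab⟩ := hs
  exact ⟨a, b, hab, ha, hb⟩

/-! ### The second part of (iii) under (∗_j) -/

/-- **Thm. 3.7 (iii), second part, under (∗_j)** (Comments (6)(b),(c)): if the compact `C`, satisfying
(∗_j), lies in two distinct verticial subgroups `H₁`, `H₂`, then every verticial subgroup containing `C`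
is `H₁` or `H₂`, and `C` lies in an edge-like subgroup of a CLOSED edge.  This is abc-iut-L3-t11's
`compactInVerticial_conj2_of_levelData` with its two tree-system steps run under (∗_j)
(`atMostTwo_systems_of_hstar`, `adjacent_of_hstar`) instead of "at most two fixed vertices".
[cite: MochizukiSemiAnbd2006, Thm 3.7(iii) p.41] -/
theorem conj2_of_hstar (hVD : VerticialDistinct.{u}) (h𝒢 : 𝒢.Thm37Hypotheses) (C : Subgroup c.G)
    (hstar : ∀ j : D.J, ∃ (i : D.J) (h : j ≤ i), ∀ e e' : (D.tree i).Edge,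
      (∀ γ : C, (D.act i γ).hom.edgeMap e = e) → (∀ γ : C, (D.act i γ).hom.edgeMap e' = e') →
      (D.trans h).edgeMap e = (D.trans h).edgeMap e')
    {v₁ v₂ : 𝒢.graph.Vertex} {H₁ H₂ : Subgroup c.G} (hH₁ : H₁ ∈ verticialSubgroups c v₁)
    (hH₂ : H₂ ∈ verticialSubgroups c v₂) (hne : H₁ ≠ H₂) (hC₁ : C ≤ H₁) (hC₂ : C ≤ H₂) :
    (∀ (v₃ : 𝒢.graph.Vertex) (H₃ : Subgroup c.G), H₃ ∈ verticialSubgroups c v₃ → C ≤ H₃ →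
        H₃ = H₁ ∨ H₃ = H₂) ∧
      ∃ (e : 𝒢.graph.Edge) (L : Subgroup c.G), 𝒢.graph.IsClosedEdge e ∧
        L ∈ edgeLikeSubgroups c e ∧ C ≤ L := by
  classical
  -- the restricted actions of `C`
  let ρC : ∀ j, C →* Aut (D.tree j) := fun j => (D.act j).comp C.subtype
  have hstarC : ∀ j : D.J, ∃ (i : D.J) (h : j ≤ i), ∀ e e' : (D.tree i).Edge,
      (∀ γ : C, (ρC i γ).hom.edgeMap e = e) → (∀ γ : C, (ρC i γ).hom.edgeMap e' = e') →
      (D.trans h).edgeMap e = (D.trans h).edgeMap e' := hstar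
  -- (I1): the two verticial subgroups fix compatible systems `x₁`, `x₂`, hence so does `C`
  obtain ⟨x₁, hx₁c, hx₁f⟩ := D.fix v₁ H₁ hH₁
  obtain ⟨x₂, hx₂c, hx₂f⟩ := D.fix v₂ H₂ hH₂
  have hx₁C : ∀ (j : D.J) (γ : C), (ρC j γ).hom.vertexMap (x₁ j) = x₁ j :=
    fun j γ => hx₁f γ (hC₁ γ.2) j
  have hx₂C : ∀ (j : D.J) (γ : C), (ρC j γ).hom.vertexMap (x₂ j) = x₂ j :=
    fun j γ => hx₂f γ (hC₂ γ.2) j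
  -- two verticial subgroups fixing the SAME system coincide (via (I2) and Thm 3.7 (ii))
  have same : ∀ {w w' : 𝒢.graph.Vertex} {K K' : Subgroup c.G}, K ∈ verticialSubgroups c w →
      K' ∈ verticialSubgroups c w' → ∀ x : ∀ j, (D.tree j).Vertex,
      (∀ ⦃i j : D.J⦄ (h : i ≤ j), (D.trans h).vertexMap (x j) = x i) →
      (∀ g ∈ K, ∀ j, (D.act j g).hom.vertexMap (x j) = x j) →
      (∀ g ∈ K', ∀ j, (D.act j g).hom.vertexMap (x j) = x j) → K = K' := by
    intro w w' K K' hK hK' x hxc hKx hK'x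
    obtain ⟨v', H', hH', hstabx⟩ := D.stab x hxc
    have h1 : K = H' := eq_of_le_of_mem_verticialSubgroups hVD h𝒢 c hK hH' fun g hg => hstabx g (hKx g hg)
    have h2 : K' = H' := eq_of_le_of_mem_verticialSubgroups hVD h𝒢 c hK' hH' fun g hg => hstabx g (hK'x g hg)
    rw [h1, h2]
  -- hence `x₁ ≠ x₂`, at some level `i`
  have hx₁₂ : ∃ i, x₁ i ≠ x₂ i := by
    by_contra hall
    push Not at hall
    have : x₁ = x₂ := funext hall
    subst this
    exact hne (same hH₁ hH₂ x₁ hx₁c hx₁f hx₂f)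
  obtain ⟨i, hi⟩ := hx₁₂
  refine ⟨fun v₃ H₃ hH₃ hC₃ => ?_, ?_⟩
  · -- ONLY TWO: a third verticial subgroup containing `C` fixes a third system, which must be `x₁` or `x₂`
    obtain ⟨x₃, hx₃c, hx₃f⟩ := D.fix v₃ H₃ hH₃
    have hx₃C : ∀ (j : D.J) (γ : C), (ρC j γ).hom.vertexMap (x₃ j) = x₃ j :=
      fun j γ => hx₃f γ (hC₃ γ.2) j
    by_cases h31 : ∃ i₁, x₃ i₁ ≠ x₁ i₁
    · by_cases h32 : ∃ i₂, x₃ i₂ ≠ x₂ i₂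
      · obtain ⟨i₁, hi₁⟩ := h31
        obtain ⟨i₂, hi₂⟩ := h32
        exact (SemiGraph.atMostTwo_systems_of_hstar D.tree ρC D.trans D.isTree hstarC
          hx₃c hx₁c hx₂c hx₃C hx₁C hx₂C hi₁ hi hi₂).elim
      · push Not at h32
        have : x₃ = x₂ := funext h32
        subst this
        exact Or.inr (same hH₃ hH₂ x₃ hx₃c hx₃f hx₂f)
    · push Not at h31
      have : x₃ = x₁ := funext h31
      subst this
      exact Or.inl (same hH₃ hH₁ x₃ hx₃c hx₃f hx₁f)
  · -- THE EDGE: at every level `j ≥ i` the fixed pair is joined by a unique closed edge, fixed with its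
    -- branches ((∗_j), `adjacent_of_hstar`); these edges form a compatible system above `i`
    have adj : ∀ j : {j : D.J // i ≤ j}, ∃ (e : (D.tree j.1).Edge) (b b' : (D.tree j.1).Branch),
        (D.tree j.1).IsClosedEdge e ∧ b ≠ b' ∧ (D.tree j.1).edgeOf b = e ∧ (D.tree j.1).edgeOf b' = e ∧
        (D.tree j.1).abuts b = some (x₁ j.1) ∧ (D.tree j.1).abuts b' = some (x₂ j.1) ∧
        ∀ γ : C, (ρC j.1 γ).hom.edgeMap e = e ∧
          ∀ b'' : (D.tree j.1).Branch, (D.tree j.1).edgeOf b'' = e → (ρC j.1 γ).hom.branchMap b'' = b'' :=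
      fun j => SemiGraph.adjacent_of_hstar D.tree ρC D.trans D.isTree hstarC hx₁c hx₂c hx₁C hx₂C hi j.2
    choose ε bε bε' hεcl hbb hbε hb'ε hbx hb'x hεfix using adj
    -- compatibility of the edges, by uniqueness of the edge joining `x₁ i'` and `x₂ i'` (`i' ≥ i`)
    have hεc : ∀ ⦃i' j : {j : D.J // i ≤ j}⦄ (h : i'.1 ≤ j.1), (D.trans h).edgeMap (ε j) = ε i' := by
      intro i' j h
      have hx12 : x₁ i'.1 ≠ x₂ i'.1 :=
        SemiGraph.ne_of_compatible_ne D.tree (fun i j h => (D.trans h).vertexMap) hx₁c hx₂c hi i'.2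
      refine SemiGraph.edge_unique_of_abuts (D.isTree i'.1) hx12 (c := (D.trans h).branchMap (bε j))
        (d := (D.trans h).branchMap (bε' j)) (c' := bε i') (d' := bε' i') ?_ ?_ (hbε i') (hb'ε i') ?_ ?_
        (hbx i') (hb'x i')
      · rw [(D.trans h).edgeOf_branchMap, hbε j]
      · rw [(D.trans h).edgeOf_branchMap, hb'ε j]
      · rw [(D.trans h).abuts_branchMap _ _ (hbx j), hx₁c h]
      · rw [(D.trans h).abuts_branchMap _ _ (hb'x j), hx₂c h]
    -- (I3): the stabiliser of the edge system lies in an edge-like subgroup `L` of the image edge `e`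
    obtain ⟨e, L, hL, hpe, hLstab⟩ := D.edge i ε hεc
    refine ⟨e, L, ?_, hL, fun g hg => hLstab g fun j => hεfix j ⟨g, hg⟩⟩
    -- `e` is closed: the image of the closed edge `ε i` with its two distinct abutting branches
    let jj : {j : D.J // i ≤ j} := ⟨i, le_rfl⟩
    rw [← hpe jj]
    refine SemiGraph.isClosedEdge_of_abuts (c := (D.proj jj.1).branchMap (bε jj))
      (c' := (D.proj jj.1).branchMap (bε' jj))
      (fun heq => hbb jj ((D.proj jj.1).branchMap_injOn _ _ (by rw [hbε jj, hb'ε jj]) heq)) ?_ ?_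
      ((D.proj jj.1).abuts_branchMap _ _ (hbx jj)) ((D.proj jj.1).abuts_branchMap _ _ (hb'x jj))
    · rw [(D.proj jj.1).edgeOf_branchMap, hbε jj]
    · rw [(D.proj jj.1).edgeOf_branchMap, hb'ε jj]

/-! ### Both conjuncts -/

/-- **Theorem 3.7 (iii) for the chart `c`, from its level data along Comments (6)**: for every compact
subgroup `C` of `π₁^temp(𝒢)`, (1) `C` lies in a verticial subgroup; (2) if `C ≠ 1` lies in two distinct
verticial subgroups then only in those two, and in an edge-like subgroup of a closed edge — modulo
Thm. 3.7 (ii) (`VerticialDistinct`), Thm. 3.7 (i) existence (`hex`) and the condition (∗_j) for every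
nontrivial compact subgroup (`hstar`, from total estrangement).  The statement proved is the body of
`ProfiniteSemiGraph.CompactInVerticial` at `𝒢`, `c`, `C`. [cite: MochizukiSemiAnbd2006, Thm 3.7(iii) pp.40-41] -/
theorem compactInVerticial_of_hstar (hVD : VerticialDistinct.{u}) (h𝒢 : 𝒢.Thm37Hypotheses)
    (hex : ∀ v : 𝒢.graph.Vertex, (verticialSubgroups c v).Nonempty)
    (hstar : ∀ C : Subgroup c.G, IsCompact (C : Set c.G) → C ≠ ⊥ →
      ∀ j : D.J, ∃ (i : D.J) (h : j ≤ i), ∀ e e' : (D.tree i).Edge,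
        (∀ γ : C, (D.act i γ).hom.edgeMap e = e) → (∀ γ : C, (D.act i γ).hom.edgeMap e' = e') →
        (D.trans h).edgeMap e = (D.trans h).edgeMap e')
    (C : Subgroup c.G) (hC : IsCompact (C : Set c.G)) :
    (∃ (v : 𝒢.graph.Vertex) (H : Subgroup c.G), H ∈ verticialSubgroups c v ∧ C ≤ H) ∧
      (C ≠ ⊥ → ∀ (v₁ v₂ : 𝒢.graph.Vertex) (H₁ H₂ : Subgroup c.G), H₁ ∈ verticialSubgroups c v₁ →
        H₂ ∈ verticialSubgroups c v₂ → H₁ ≠ H₂ → C ≤ H₁ → C ≤ H₂ →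
          (∀ (v₃ : 𝒢.graph.Vertex) (H₃ : Subgroup c.G), H₃ ∈ verticialSubgroups c v₃ → C ≤ H₃ →
              H₃ = H₁ ∨ H₃ = H₂) ∧
          ∃ (e : 𝒢.graph.Edge) (L : Subgroup c.G), 𝒢.graph.IsClosedEdge e ∧
            L ∈ edgeLikeSubgroups c e ∧ C ≤ L) := by
  refine ⟨?_, fun hC1 v₁ v₂ H₁ H₂ hH₁ hH₂ hne hC₁ hC₂ =>
    D.conj2_of_hstar hVD h𝒢 C (hstar C hC hC1) hH₁ hH₂ hne hC₁ hC₂⟩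
  by_cases hC1 : C = ⊥
  · -- the trivial subgroup lies in any verticial subgroup (`𝒢` has a vertex, Thm. 3.7 (i))
    obtain ⟨v⟩ := h𝒢.hasVertex
    obtain ⟨H, hH⟩ := hex v
    exact ⟨v, H, hH, by rw [hC1]; exact bot_le⟩
  · exact D.conj1_of_hstar C hC hex (hstar C hC hC1)

/-- **`CompactInVerticial` (Thm. 3.7 (iii) as typed) REDUCED to Thm. 3.7 (ii) (`VerticialDistinct`),
Thm. 3.7 (i) (`VerticialInjective`, for the existence of verticial subgroups) and the existence, for
every chart of every `𝒢` satisfying the hypotheses of Thm. 3.7, of level data satisfying (∗_j) for all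
nontrivial compact subgroups (rung 1 + the estrangement step of Comments (6)(b)).**
[cite: MochizukiSemiAnbd2006, Thm 3.7(iii) pp.40-41] -/
theorem compactInVerticial_of (hVD : VerticialDistinct.{u}) (hVI : VerticialInjective.{u})
    (hD : ∀ (𝒢 : ProfiniteSemiGraph.{u}), 𝒢.Thm37Hypotheses → ∀ (c : TemperedPiChart 𝒢),
      ∃ D : VerticialLevelData.{v} 𝒢 c, ∀ C : Subgroup c.G, IsCompact (C : Set c.G) → C ≠ ⊥ →
        ∀ j : D.J, ∃ (i : D.J) (h : j ≤ i), ∀ e e' : (D.tree i).Edge,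
          (∀ γ : C, (D.act i γ).hom.edgeMap e = e) → (∀ γ : C, (D.act i γ).hom.edgeMap e' = e') →
          (D.trans h).edgeMap e = (D.trans h).edgeMap e') :
    CompactInVerticial.{u} := by
  intro 𝒢 h𝒢 c C hC
  obtain ⟨D, hstar⟩ := hD 𝒢 h𝒢 c
  exact D.compactInVerticial_of_hstar hVD h𝒢 (fun v => (hVI 𝒢 h𝒢 c v).1) hstar C hC

end VerticialLevelData

end ProfiniteSemiGraph

end Literature.AnabelianGeometry.SemiGraphs
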